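import Mathlib.Algebra.Order.Chebyshev
import Literature.Geometry.Lorentzian.MetricNormSq
import Literature.Geometry.Lorentzian.Hypersurface
import HarnessLib

/-!
# `½ H² ≤ |A|²` for immersed surfaces
(family `gr`; an inline lemma of the discharge programme of the named fact
`Literature.Geometry.Lorentzian.geroch_monotonicity_smooth` of `InverseMeanCurvatureFlow.lean`)

For a spacelike immersion `f : N → (M, g)` of a surface `N` (modelled on `ℝ²`) with a field `ν`
along it, the second fundamental form `A = K_ν` (`secondFundamentalForm`) and the mean curvature
`H = tr_{f^*g} A` (`meanCurvature`) satisfy the pointwise inequality `½ H² ≤ |A|²_{f^*g}`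
(`half_meanCurvature_sq_le_normSq_secondFundamentalForm`), `|A|²` being the metric square norm
`normSq` of `PseudoRiemannianMetric.lean` w.r.t. the induced metric. For symmetric `A` with
principal curvatures `λ₁, λ₂` this is `|A|² = ½H² + ½(λ₁-λ₂)² ≥ ½H²`, the step of
Huisken–Ilmanen's Monotonicity Calculation (J. Differential Geom. 59 (2001), §5) passing from
`∫(-|A|² + …)` to `∫(-½H² - ½(λ₁-λ₂)² + …) ≤ ∫(-½H² + …)`.

It is the case `d = 2` of the Cauchy–Schwarz inequality `(tr_g T)² ≤ d · |T|²_g` for a Riemannian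
fibre metric (in a `g`-orthogonal frame `e` with `cᵢ = g(eᵢ,eᵢ) > 0`: `tr_g T = ∑ᵢ T(eᵢ,eᵢ)/cᵢ`,
`|T|²_g = ∑ᵢⱼ T(eⱼ,eᵢ)²/(cᵢcⱼ) ≥ ∑ᵢ (T(eᵢ,eᵢ)/cᵢ)²`). That inequality is already in the tree as
`PseudoRiemannianMetric.trace_sq_le_finrank_mul_normSq`
(`Literature/Geometry/Riemannian/RicciFlowScalarCurvatureComparison.lean`, whose imports are the
Ricci-flow files); to keep the inverse-mean-curvature-flow files independent of those, the short
frame computation is redone here as private lemmas on top of `MetricNormSq.lean`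
(`exists_isOrthoᵢ_basis`, `repr_eq_div_of_isOrthoᵢ`, `normSq_eq_sum_sq`).

## References

* G. Huisken, T. Ilmanen, *The inverse mean curvature flow and the Riemannian Penrose
  inequality*, J. Differential Geom. 59 (2001), §5, Monotonicity Calculation
  (`|A|² = ½H² + ½(λ₁-λ₂)²`).
* B. O'Neill, *Semi-Riemannian geometry*, Academic Press 1983, Ch. 3, pp. 60–61 (metric
  contraction in a frame).
-/

open Manifold Bundle Finset Module
open scoped ContDiff Topology

noncomputable section

namespace Literature.Geometry.Lorentzian

namespace PseudoRiemannianMetric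

section Fibre

variable
  {EB : Type*} [NormedAddCommGroup EB] [NormedSpace ℝ EB]
  {HB : Type*} [TopologicalSpace HB] {IB : ModelWithCorners ℝ EB HB} {n : ℕ∞ω}
  {B : Type*} [TopologicalSpace B] [ChartedSpace HB B]
  {F : Type*} [NormedAddCommGroup F] [NormedSpace ℝ F] [FiniteDimensional ℝ F]
  {E : B → Type*} [TopologicalSpace (TotalSpace F E)]
  [∀ b, TopologicalSpace (E b)] [∀ b, AddCommGroup (E b)] [∀ b, Module ℝ (E b)]
  [FiberBundle F E] [VectorBundle ℝ F E]
  (g : PseudoRiemannianMetric IB n F E) (b : B)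

/-- The metric trace in a `g_b`-orthogonal frame of non-null vectors:
`tr_g T = ∑ᵢ T(eᵢ, eᵢ) / g(eᵢ, eᵢ)` (local copy of the frame formula of
`RicciFlowScalarCurvatureComparison.lean`). [folklore] -/
private theorem trace_eq_sum_div {ι : Type*} [Fintype ι] [DecidableEq ι]
    (e : Basis ι ℝ (E b)) (he : (g.toBilinForm b).IsOrthoᵢ e)
    (hc : ∀ i, g.val b (e i) (e i) ≠ 0) (T : LinearMap.BilinForm ℝ (E b)) :
    g.trace b T = ∑ i, T (e i) (e i) / g.val b (e i) (e i) := by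
  classical
  rw [PseudoRiemannianMetric.trace, LinearMap.trace_eq_matrix_trace ℝ e, Matrix.trace]
  refine Finset.sum_congr rfl fun i _ ↦ ?_
  rw [Matrix.diag_apply, LinearMap.toMatrix_apply, repr_eq_div_of_isOrthoᵢ e he hc,
    LinearMap.comp_apply]
  simp

/-- Cauchy–Schwarz for the metric trace of a Riemannian fibre metric:
`(tr_g T)² ≤ dim (E b) · |T|²_g` (local copy, stated with the fibre dimension). [folklore] -/
private theorem trace_sq_le_finrank_fibre_mul_normSq (hg : g.IsRiemannian)
    (T : LinearMap.BilinForm ℝ (E b)) :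
    g.trace b T ^ 2 ≤ finrank ℝ (E b) * g.normSq b T := by
  classical
  obtain ⟨e, he, -⟩ := g.exists_isOrthoᵢ_basis b
  have hpos : ∀ i, 0 < g.val b (e i) (e i) := fun i ↦ hg b (e i) (e.ne_zero i)
  have hc : ∀ i, g.val b (e i) (e i) ≠ 0 := fun i ↦ (hpos i).ne'
  rw [g.trace_eq_sum_div b e he hc T, g.normSq_eq_sum_sq b e he hc T]
  calc (∑ i, T (e i) (e i) / g.val b (e i) (e i)) ^ 2
      ≤ #(univ : Finset (Fin (finrank ℝ (E b)))) *
          ∑ i, (T (e i) (e i) / g.val b (e i) (e i)) ^ 2 := sq_sum_le_card_mul_sum_sq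
    _ = finrank ℝ (E b) * ∑ i, (T (e i) (e i) / g.val b (e i) (e i)) ^ 2 := by
        rw [Finset.card_univ, Fintype.card_fin]
    _ ≤ finrank ℝ (E b) *
          ∑ i, ∑ j, T (e j) (e i) ^ 2 / (g.val b (e i) (e i) * g.val b (e j) (e j)) := by
        gcongr with i
        calc (T (e i) (e i) / g.val b (e i) (e i)) ^ 2
            = T (e i) (e i) ^ 2 / (g.val b (e i) (e i) * g.val b (e i) (e i)) := by
              rw [div_pow, sq (g.val b (e i) (e i))]
          _ ≤ ∑ j, T (e j) (e i) ^ 2 / (g.val b (e i) (e i) * g.val b (e j) (e j)) :=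
              Finset.single_le_sum
                (f := fun j ↦ T (e j) (e i) ^ 2 / (g.val b (e i) (e i) * g.val b (e j) (e j)))
                (fun j _ ↦ div_nonneg (sq_nonneg _) (mul_pos (hpos i) (hpos j)).le)
                (Finset.mem_univ i)

end Fibre

/-! ### The second fundamental form of a surface -/

section Surface

variable {E : Type*} [NormedAddCommGroup E] [NormedSpace ℝ E] {H : Type*} [TopologicalSpace H]
  {I : ModelWithCorners ℝ E H} {M : Type*} [TopologicalSpace M] [ChartedSpace H M]
  [IsManifold I ∞ M] {n : ℕ∞ω}
  {N : Type*} [TopologicalSpace N] [ChartedSpace (EuclideanSpace ℝ (Fin 2)) N]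
  [IsManifold (𝓡 2) ∞ N] [FiniteDimensional ℝ E]
  (g : PseudoRiemannianMetric I n E (TangentSpace I : M → Type _)) [g.HasLeviCivita]
  (f : N → M)

/-- **`½ H² ≤ |A|²` for an immersed surface.** For a spacelike immersion `f` of a surface `N`
(modelled on `ℝ²`) into `(M, g)` and any field `ν` along `f`, the second fundamental form
`A = K_ν` and the mean curvature `H = tr_{f^*g} A` (`meanCurvature`) satisfy
`½ H(y)² ≤ |A(y)|²_{f^*g}` at every point, `|A|²` being the metric square norm `normSq` w.r.t. the
induced (Riemannian) metric `inducedMetric`: the case `d = 2` of the Cauchy–Schwarz inequality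
`(tr T)² ≤ d |T|²`. For symmetric `A` with principal curvatures `λ₁, λ₂`,
`|A|² = ½H² + ½(λ₁-λ₂)²`; Huisken–Ilmanen, J. Differential Geom. 59 (2001), §5, Monotonicity
Calculation, use it in the form `-|A|² = -½H² - ½(λ₁-λ₂)² ≤ -½H²`.
[cite: HuiskenIlmanenIMCF2001, §5 Monotonicity Calculation (|A|² = ½H² + ½(λ₁−λ₂)²)] -/
theorem half_meanCurvature_sq_le_normSq_secondFundamentalForm
    (hpb : contMDiff_pullbackBilin I M (𝓡 2) N n) (hf : g.IsSpacelikeImmersion (𝓡 2) f)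
    (ν : NormalField I f) (y : N) :
    2⁻¹ * g.meanCurvature f hpb hf ν y ^ 2 ≤
      (g.inducedMetric f hpb hf).normSq y (g.secondFundamentalForm (𝓡 2) f ν y) := by
  have h := (g.inducedMetric f hpb hf).trace_sq_le_finrank_fibre_mul_normSq y
    (g.isRiemannian_inducedMetric f hpb hf) (g.secondFundamentalForm (𝓡 2) f ν y)
  have hd : finrank ℝ (TangentSpace (𝓡 2) y) = 2 := finrank_euclideanSpace_fin
  rw [hd] at h
  rw [meanCurvature]
  push_cast at h
  linarith

end Surface

end PseudoRiemannianMetric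

end Literature.Geometry.Lorentzian

end
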